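import Summits.QuantumFields.BalabanUV.Beta.GAN24.HkKingOneStepSup

/-!
# G-an2-4 ∕ (CONV-C), route R7 — THE FULL-SEQUENCE `η¹`-RATE OF BAŁABAN's FINE MINIMISER `H^{(η)} = H_n` (B5 (1.63)) AT `U = 1`, EVERY
# TORUS, KERNEL CURRENCY WITH EXPONENTIAL DECAY, BETWEEN ANY TWO SPACINGS `η = 1∕n`, `η′ = 1∕m` (no divisibility):
# `‖H_m((m·ȳ′+⌊m t⌋, μ), (ȳ, λ)) − H_n((n·ȳ′+⌊n t⌋, μ), (ȳ, λ))‖ ≤ KHc(d)·(η + η′)·e^{−dec(d)|y′−y|_T}` at every continuum block offset `t ≥ 0`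
# — PART 1 of 2 (the Cauchy estimate + the carrier-free limit lemma + King's ancestry); PART 2 `HkContinuumKernelLimit` names the `η → 0` kernel

G-an2-4 formalisation swarm `b2b-balaban-gan24-formalise-*`, leaf prover 06 (gen 38), crux team (2) under the coordinator ruling «YM REDIRECT»
(e34b3e0c; FREEZE (0) honoured — a `GAN24/` corollary importing ONE existing module; announced statement-first as INTENT 1 «HK-CONTINUUM-KERNEL»,
journal `HOME/CLAIMS.log` 2026-08-21 l.31931, hold-off honoured; split in two by the 400-line rule).  NOT IN PRINT; OUR BOOKKEEPING over tree
theorems BY NAME.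

## Why

`HkKingOneStep` ∕ `HkKingOneStepSup` (gan24-p3 gen 27) give the two (CONV-C) clauses of the FINE constituent `H` at `U = 1` along King's towers:
k-uniform decay and the one-step law `‖H_{RN}(RN·ȳ′+a′) − H_N(N·ȳ′+⌊a′∕R⌋)‖ ≤ KH1∕N·e^{−dec|y′−y|}` against King's block-parent map.  What the
row's END-grade currency (`|s_k − s_∞| ≤ c₀θ^k`, asym1's `LimitForm.conv` ∕ `Beta.RateCertificate`) and [Balaban1987RG1]'s deferred
«separate paper» comparison consume is a LIMIT OBJECT WITH A RATE.  For the UNIT-lattice constituents the carrier is fixed and this lineage's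
`AveragedPropagatorTowerDecayCubic` ∕ `AveragedPropagatorInverseTowerDecayCubic` (gen 37) name the limits along towers.  For the FINE constituent the
carrier grows with the level; the coherent-address device — read `H_n` at the fine point over the DIGITS `⌊n t⌋` of one continuum offset `t` of the
unit block (for `n = L^k` these digits ARE King's ancestry: the parent digit of `⌊L·N·t⌋` is `⌊N·t⌋`, §4) — names it, and because the NE2 lane's
strip law behind `HkKingOneStep` §2 is LOG-FREE the comparison runs between ANY two spacings through their common refinement `n·m`, giving the
FULL `η¹` rate of the whole sequence (for the unit constituents the road-P2 chair's two-level law carries `log(RN)`, so `log(nm)∕n` is unbounded in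
`m` and only towers are available — gen 37's packaging).

## What is proved (0 sorry, 0 def; constants explicit, `d`-only, the suppliers')

Write `KHc(d) := CGe(d+1)·periodConst(κ₁₆₃(d+1), d) + (d+1)·KHd(d)` (displayed inline; `CGe` = NE2's strip-rate constant, `KHd` = b05's one-step
displacement constant of `HkKingOneStep` §0) and `E(y′,y) := e^{−dec(d)·|y′−y|_{T,∞}}`.
 * §0 (carrier-free, the full-sequence twin of gen 37's tower packaging) **`exists_limit_of_pairwise_rate`**: a level family
   `u : (n : ℕ) → [NeZero n] → E` in a complete normed group with `‖u m − u n‖ ≤ K·(n⁻¹ + m⁻¹)·w` for all `n, m ≥ 1` has a limit `u_∞`: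
   `u (k+1) → u_∞`, `‖u n − u_∞‖ ≤ K·n⁻¹·w` for every `n ≥ 1`, `‖u_∞‖ ≤ ‖u 1‖ + K·w`; and **`le_of_forall_level`** (`x ≤ C·n⁻¹ + D ∀ n ≥ 1 ⇒ x ≤ D`).
 * §1 **`norm_hker_bpt_sub_bpt_le`**: NON-monotone in-block displacement `‖H_n(n·ȳ′+A; ȳ) − H_n(n·ȳ′+B; ȳ)‖ ≤ (Σ_ν |A_ν − B_ν|)·n⁻¹·KHd·E`
   (`HkKingOneStep.norm_hker_bpt_mono_sub_le` twice, through the componentwise minimum).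
 * §2 **`norm_HkOp_sub_of_overlap_le`** — TWO ARBITRARY LEVELS `n, m ≥ 1`: for offsets `a ∈ (Fin n)^{d+1}`, `a′ ∈ (Fin m)^{d+1}` whose fine cells
   OVERLAP in every direction (`a_ν·m < (a′_ν+1)·n ∧ a′_ν·n < (a_ν+1)·m`),
   `‖H_m((m·ȳ′+a′,μ),(ȳ,λ)) − H_n((n·ȳ′+a,μ),(ȳ,λ))‖ ≤ KHc·(n⁻¹ + m⁻¹)·E` — through level `n·m`: `HkKingOneStep.norm_HkOp_sub_samePhys_le`
   (= the LITERATURE strip rate `T4Hk163StripRate.torusKernel_G163_rate`) at `(n ≤ nm, a ↦ a·m)` and `(m ≤ nm, a′ ↦ a′·n)`, and §1 at level `nm` with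
   `Σ_ν |a_ν m − a′_ν n| ≤ (d+1)(n+m)`; **`floor_cells_overlap`** (the digits `⌊n s⌋`, `⌊m s⌋` of one real `s ≥ 0` overlap) and the corollary
   **`norm_HkOp_floor_sub_floor_le`** = THE `η`-RATE CAUCHY ESTIMATE at the digits of one continuum offset `t` (hypothesis form, no `def`).
 * §3 digit bookkeeping: **`floor_lt_level`** (`⌊n s⌋ < n` for `s ∈ [0,1)`), **`abs_floor_sub_floor_le`** (`|⌊x⌋ − ⌊y⌋| ≤ |x − y| + 1`).
 * §4 the King reading: **`floor_mul_div`** (`⌊(L·N)·s⌋ ∕ L = ⌊N·s⌋`) and **`par_bpt_floor`** — King's parent (`BalabanAveragedTowerModes.par`,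
   through `HkKingOneStepSup.par_bpt`) of the level-`L·N` coherent point IS the level-`N` coherent point, so `HkKingOneStep.norm_HkOp_king_sub_le` is
   the consecutive-level case of §2 and every King tower sits inside one convergent sequence (PART 2).

HONEST SCOPE.  [folklore] corollary BY NAME of `HkKingOneStep` §1–§3 (hence of NE2's `torusKernel_G163_rate` and b05's `norm_dker_bpt_le`) plus real
analysis; `U = 1` (the abelian (1.63) operator ⊗ id); every torus `M`, constants `d`-only, crude; no `G_k(U)`, no `C^{(k)}`, no general `U`, non-abelian
nothing.  NOT (CONV-C) as typed, NEVER «G-an2-4 closed», NOT NE2 ∕ NE3, NOT D1, NOT BetaPertH, NOT continuum YM, NOT Clay; 0 def, no sorry.  Locators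
(text only): [Balaban1984PropagatorsI] (1.63) p. 28; [King1986] p. 664 (the pairing `x′ ↦ x`); [Balaban1987RG1] p. 264 (the deferred
comparison).  HONEST DEPENDENCY: continuum YM on T⁴ ⇐ BetaPertH ∧ nine spine estimates (0/9 proved); BetaPertH ⇐ (D1) ∧ (D4) ∧ CAP+tail; G-an2-4
gates asym, D1 and NE2/3/4.  Provenance: prover-b2b-balaban-gan24-formalise-leaf-06-g38-0 (unit `b2b-balaban-gan24-formalise-leaf-06`, gen 38),
2026-08-21.
-/


noncomputable section

open scoped BigOperators ComplexConjugate Matrix Topology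
open Finset

namespace Summit.QuantumFields.BalabanUV.Beta.GAN24.HkContinuumKernel

open Filter
open Literature.MathematicalPhysics.QuantumFieldTheory.Balaban1983to89
open Literature.MathematicalPhysics.QuantumFieldTheory.Balaban1983to89.B5Prop11Plancherel (Tor fine)
open Literature.MathematicalPhysics.QuantumFieldTheory.Balaban1983to89.B4TorusKernel (periodConst)
open Literature.MathematicalPhysics.QuantumFieldTheory.Balaban1983to89.B4TorusKernel.MultiPeriod (torusSupNorm)
open Literature.MathematicalPhysics.QuantumFieldTheory.Balaban1983to89.B5Block118 (bpt)
open Literature.MathematicalPhysics.QuantumFieldTheory.Balaban1983to89.B5Kernel166Decay (periodConst_pos)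
open Literature.MathematicalPhysics.QuantumFieldTheory.Balaban1983to89.B6LowerBound2153Torus (toT rep toT_rep)
open Literature.MathematicalPhysics.QuantumFieldTheory.Balaban1983to89.B5Hk163Strip (kappa163 kappa163_pos)
open Literature.MathematicalPhysics.QuantumFieldTheory.Balaban1983to89.B5Hk163Decay (MG163 MG163_nonneg)
open Literature.MathematicalPhysics.QuantumFieldTheory.Balaban1983to89.B5Hk163Torus (hker HkOp)
open Literature.MathematicalPhysics.QuantumFieldTheory.Balaban1983to89.T4Hk163StripRate (CGe CGe_nonneg)
open Summit.QuantumFields.BalabanUV.T4Continuum.BalabanAveragedTowerModes (par)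
open Summit.QuantumFields.BalabanUV.Beta.GAN24.HkKingOneStep (dec dec_pos KHd KHd_nonneg norm_HkOp_bpt_le norm_HkOp_sub_samePhys_le
  norm_hker_bpt_mono_sub_le)
open Summit.QuantumFields.BalabanUV.Beta.GAN24.HkKingOneStepSup (par_bpt)

variable {d : ℕ}

/-! ## §0 Carrier-free: a pairwise rate `K·(n⁻¹ + m⁻¹)·w` gives a limit with the tail `K·n⁻¹·w` -/

section Generic

/-- `((k : ℝ) + 1)⁻¹ → 0`. [folklore] -/
theorem tendsto_inv_natCast_succ : Tendsto (fun k : ℕ => ((k : ℝ) + 1)⁻¹) atTop (𝓝 0) := by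
  simpa [one_div] using tendsto_one_div_add_atTop_nhds_zero_nat (𝕜 := ℝ)

/-- **passing to the limit in the level**: if `x ≤ C·n⁻¹ + D` for every level `n ≥ 1`, then `x ≤ D`. [folklore] -/
theorem le_of_forall_level {x C D : ℝ} (h : ∀ (n : ℕ) [NeZero n], x ≤ C * ((n : ℝ))⁻¹ + D) : x ≤ D := by
  have hlim : Tendsto (fun k : ℕ => C * ((k : ℝ) + 1)⁻¹ + D) atTop (𝓝 (C * 0 + D)) :=
    (tendsto_inv_natCast_succ.const_mul C).add_const D
  rw [mul_zero, zero_add] at hlim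
  refine ge_of_tendsto hlim (Eventually.of_forall fun k => ?_)
  have hk := h (k + 1)
  push_cast at hk
  exact hk

variable {E : Type*} [NormedAddCommGroup E] [CompleteSpace E]

/-- **THE LIMIT OF A LEVEL FAMILY WITH A PAIRWISE RATE** (carrier-free): if `u : (n : ℕ) → [NeZero n] → E` (complete normed group) satisfies
`‖u m − u n‖ ≤ K·(n⁻¹ + m⁻¹)·w` for all levels `n, m ≥ 1`, then there is `u_∞` with `u (k+1) → u_∞`, `‖u n − u_∞‖ ≤ K·n⁻¹·w` for EVERY `n ≥ 1`
(the full-sequence `η¹` tail), and `‖u_∞‖ ≤ ‖u 1‖ + K·w`. [folklore] -/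
theorem exists_limit_of_pairwise_rate (u : (n : ℕ) → [NeZero n] → E) {K w : ℝ}
    (h : ∀ (n m : ℕ) [NeZero n] [NeZero m], ‖u m - u n‖ ≤ K * (((n : ℝ))⁻¹ + ((m : ℝ))⁻¹) * w) :
    ∃ uinf : E, Tendsto (fun k : ℕ => u (k + 1)) atTop (𝓝 uinf) ∧
      (∀ (n : ℕ) [NeZero n], ‖u n - uinf‖ ≤ K * ((n : ℝ))⁻¹ * w) ∧ ‖uinf‖ ≤ ‖u 1‖ + K * w := by
  set v : ℕ → E := fun k => u (k + 1) with hv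
  -- the sign of `K·w` is not assumed: it follows from the hypothesis at `n = m = 1`
  have hKw : 0 ≤ K * w := by
    have h11 := (norm_nonneg _).trans (h 1 1)
    norm_num at h11
    linarith
  have hcau : CauchySeq v := by
    refine cauchySeq_of_le_tendsto_0 (fun N : ℕ => K * (((N : ℝ) + 1)⁻¹ + ((N : ℝ) + 1)⁻¹) * w) (fun n m N hn hm => ?_) ?_
    · rw [dist_eq_norm, ← norm_neg, neg_sub]
      have key := h (n + 1) (m + 1)
      push_cast at key
      refine key.trans ?_
      have hn' : ((n : ℝ) + 1)⁻¹ ≤ ((N : ℝ) + 1)⁻¹ :=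
        inv_anti₀ (by positivity) (by exact_mod_cast Nat.add_le_add_right hn 1)
      have hm' : ((m : ℝ) + 1)⁻¹ ≤ ((N : ℝ) + 1)⁻¹ :=
        inv_anti₀ (by positivity) (by exact_mod_cast Nat.add_le_add_right hm 1)
      calc K * (((n : ℝ) + 1)⁻¹ + ((m : ℝ) + 1)⁻¹) * w = (((n : ℝ) + 1)⁻¹ + ((m : ℝ) + 1)⁻¹) * (K * w) := by ring
        _ ≤ (((N : ℝ) + 1)⁻¹ + ((N : ℝ) + 1)⁻¹) * (K * w) := mul_le_mul_of_nonneg_right (add_le_add hn' hm') hKw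
        _ = K * (((N : ℝ) + 1)⁻¹ + ((N : ℝ) + 1)⁻¹) * w := by ring
    · simpa using ((tendsto_inv_natCast_succ.add tendsto_inv_natCast_succ).const_mul K).mul_const w
  obtain ⟨uinf, huinf⟩ := cauchySeq_tendsto_of_complete hcau
  have htail : ∀ (n : ℕ) [NeZero n], ‖u n - uinf‖ ≤ K * ((n : ℝ))⁻¹ * w := by
    intro n _
    have hg : Tendsto (fun m : ℕ => ‖u n - v m‖) atTop (𝓝 ‖u n - uinf‖) := (tendsto_const_nhds.sub huinf).norm
    have hb : Tendsto (fun m : ℕ => K * (((m : ℝ) + 1)⁻¹ + ((n : ℝ))⁻¹) * w) atTop (𝓝 (K * (0 + ((n : ℝ))⁻¹) * w)) :=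
      ((tendsto_inv_natCast_succ.add tendsto_const_nhds).const_mul K).mul_const w
    rw [zero_add] at hb
    refine le_of_tendsto_of_tendsto' hg hb fun m => ?_
    have key := h (m + 1) n
    push_cast at key
    exact key
  refine ⟨uinf, huinf, htail, ?_⟩
  have h0 := htail 1
  rw [Nat.cast_one, inv_one, mul_one] at h0
  calc ‖uinf‖ = ‖u 1 - (u 1 - uinf)‖ := by rw [sub_sub_cancel]
    _ ≤ ‖u 1‖ + ‖u 1 - uinf‖ := norm_sub_le _ _
    _ ≤ ‖u 1‖ + K * w := add_le_add le_rfl h0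

end Generic

/-! ## §1 Displacement inside the block between ARBITRARY offsets -/

section Displacement

variable (n : ℕ) [NeZero n] (M : Fin (d + 1) → ℕ) [hM : ∀ μ, NeZero (M μ)]

/-- **non-monotone in-block displacement**: for any two offsets `A, B ∈ (Fin n)^{d+1}`,
`‖H_n(n·ȳ′+A; ȳ) − H_n(n·ȳ′+B; ȳ)‖ ≤ (Σ_ν |A_ν − B_ν|)·n⁻¹·KHd(d)·e^{−dec·|y′−y|_T}` — `HkKingOneStep.norm_hker_bpt_mono_sub_le` from the
componentwise minimum `A ∧ B` to `A` and to `B`, and `(A_ν − (A∧B)_ν) + (B_ν − (A∧B)_ν) = |A_ν − B_ν|`. [folklore] -/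
theorem norm_hker_bpt_sub_bpt_le (μ lam : Fin (d + 1)) (x' x : Fin (d + 1) → ℤ) (A B : Fin (d + 1) → Fin n) :
    ‖hker n M μ lam (bpt n M (toT M x') A) (toT M x) - hker n M μ lam (bpt n M (toT M x') B) (toT M x)‖
      ≤ (∑ ν, |((A ν : ℕ) : ℝ) - ((B ν : ℕ) : ℝ)|) * ((n : ℝ)⁻¹ * (KHd d * Real.exp (-(dec d * torusSupNorm M (x' - x))))) := by
  set C : Fin (d + 1) → Fin n := fun ν => ⟨min (A ν : ℕ) (B ν : ℕ), lt_of_le_of_lt (min_le_left _ _) (A ν).isLt⟩ with hC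
  have hCA : ∀ ν, (C ν : ℕ) ≤ A ν := fun ν => min_le_left _ _
  have hCB : ∀ ν, (C ν : ℕ) ≤ B ν := fun ν => min_le_right _ _
  have hA := norm_hker_bpt_mono_sub_le n M μ lam x' x C A hCA
  have hB := norm_hker_bpt_mono_sub_le n M μ lam x' x C B hCB
  have hsum : (∑ ν, (((A ν : ℕ) : ℝ) - ((C ν : ℕ) : ℝ))) + (∑ ν, (((B ν : ℕ) : ℝ) - ((C ν : ℕ) : ℝ)))
      = ∑ ν, |((A ν : ℕ) : ℝ) - ((B ν : ℕ) : ℝ)| := by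
    rw [← Finset.sum_add_distrib]
    refine Finset.sum_congr rfl fun ν _ => ?_
    have hCν : ((C ν : ℕ) : ℝ) = min ((A ν : ℕ) : ℝ) ((B ν : ℕ) : ℝ) := by
      rw [← Nat.cast_min]
    rw [hCν]
    rcases le_total ((A ν : ℕ) : ℝ) ((B ν : ℕ) : ℝ) with h | h
    · rw [min_eq_left h, abs_of_nonpos (sub_nonpos.mpr h)]; ring
    · rw [min_eq_right h, abs_of_nonneg (sub_nonneg.mpr h)]; ring
  calc ‖hker n M μ lam (bpt n M (toT M x') A) (toT M x) - hker n M μ lam (bpt n M (toT M x') B) (toT M x)‖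
      ≤ ‖hker n M μ lam (bpt n M (toT M x') A) (toT M x) - hker n M μ lam (bpt n M (toT M x') C) (toT M x)‖
        + ‖hker n M μ lam (bpt n M (toT M x') B) (toT M x) - hker n M μ lam (bpt n M (toT M x') C) (toT M x)‖ := by
        rw [← norm_neg (hker n M μ lam (bpt n M (toT M x') B) (toT M x) - _), neg_sub]
        exact norm_sub_le_norm_sub_add_norm_sub _ _ _
    _ ≤ _ := add_le_add hA hB
    _ = _ := by rw [← add_mul, hsum]

end Displacement

/-! ## §2 Two ARBITRARY levels at overlapping fine cells: through the common refinement `n·m` -/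

section TwoLevels

variable {n m : ℕ} [NeZero n] [NeZero m] (M : Fin (d + 1) → ℕ) [hM : ∀ μ, NeZero (M μ)]

/-- **TWO ARBITRARY LEVELS AT OVERLAPPING FINE CELLS, `U = 1`, EVERY TORUS**: for levels `n, m ≥ 1` (no divisibility), unit points `ȳ′, ȳ`,
components `μ, λ`, and offsets `a ∈ (Fin n)^{d+1}`, `a′ ∈ (Fin m)^{d+1}` whose fine cells `[a_ν∕n, (a_ν+1)∕n)` and `[a′_ν∕m, (a′_ν+1)∕m)` OVERLAP
in every direction (`a_ν·m < (a′_ν+1)·n` and `a′_ν·n < (a_ν+1)·m`):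
`‖H_m((m·ȳ′+a′,μ),(ȳ,λ)) − H_n((n·ȳ′+a,μ),(ȳ,λ))‖ ≤ (CGe(d+1)·periodConst + (d+1)·KHd(d))·(n⁻¹ + m⁻¹)·e^{−dec(d)·|y′−y|_T}`.
Mechanism: both entries are compared with level `n·m` at the lifted offsets `a·m`, `a′·n` (SAME physical positions: `HkKingOneStep.norm_HkOp_sub_samePhys_le`,
costs `CGe·pc∕n` and `CGe·pc∕m`), and the two lifted offsets differ by `< max(n,m) ≤ n + m` fine steps of level `n·m` per direction (§1, cost
`(d+1)(n+m)·(nm)⁻¹·KHd = (d+1)·KHd·(n⁻¹ + m⁻¹)`). [folklore] -/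
theorem norm_HkOp_sub_of_overlap_le (μ lam : Fin (d + 1)) (x' x : Fin (d + 1) → ℤ) (a : Fin (d + 1) → Fin n)
    (a' : Fin (d + 1) → Fin m)
    (hover : ∀ ν, (a ν : ℕ) * m < ((a' ν : ℕ) + 1) * n ∧ (a' ν : ℕ) * n < ((a ν : ℕ) + 1) * m) :
    ‖HkOp m M (bpt m M (toT M x') a', μ) (toT M x, lam) - HkOp n M (bpt n M (toT M x') a, μ) (toT M x, lam)‖
      ≤ (CGe (d + 1) * periodConst (kappa163 (d + 1)) d + (d + 1) * KHd d) * (((n : ℝ))⁻¹ + ((m : ℝ))⁻¹)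
          * Real.exp (-(dec d * torusSupNorm M (x' - x))) := by
  have hn : 1 ≤ n := Nat.pos_of_ne_zero (NeZero.ne n)
  have hm : 1 ≤ m := Nat.pos_of_ne_zero (NeZero.ne m)
  -- the two offsets read at the common refinement level `n·m`
  set A : Fin (d + 1) → Fin (n * m) := fun ν => ⟨(a ν : ℕ) * m, Nat.mul_lt_mul_of_pos_right (a ν).isLt hm⟩ with hA
  set A' : Fin (d + 1) → Fin (n * m) :=
    fun ν => ⟨(a' ν : ℕ) * n, by rw [Nat.mul_comm n m]; exact Nat.mul_lt_mul_of_pos_right (a' ν).isLt hn⟩ with hA'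
  have h1 := norm_HkOp_sub_samePhys_le (n := n) (m := n * m) M hn (Nat.le_mul_of_pos_right n hm) μ lam a A
    (fun ν => by show (a ν : ℕ) * m * n = (a ν : ℕ) * (n * m); ring) x' x
  have h2 := norm_HkOp_sub_samePhys_le (n := m) (m := n * m) M hm (Nat.le_mul_of_pos_left m hn) μ lam a' A'
    (fun ν => by show (a' ν : ℕ) * n * m = (a' ν : ℕ) * (n * m); ring) x' x
  have h3 : ‖HkOp (n * m) M (bpt (n * m) M (toT M x') A, μ) (toT M x, lam) - HkOp (n * m) M (bpt (n * m) M (toT M x') A', μ) (toT M x, lam)‖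
      ≤ (∑ ν, |((A ν : ℕ) : ℝ) - ((A' ν : ℕ) : ℝ)|)
          * (((n * m : ℕ) : ℝ)⁻¹ * (KHd d * Real.exp (-(dec d * torusSupNorm M (x' - x))))) :=
    norm_hker_bpt_sub_bpt_le (n * m) M μ lam x' x A A'
  set e : ℝ := Real.exp (-(dec d * torusSupNorm M (x' - x))) with he
  have he0 : 0 < e := Real.exp_pos _
  have hKHd := KHd_nonneg d
  have hn0 : (0 : ℝ) < n := by exact_mod_cast hn
  have hm0 : (0 : ℝ) < m := by exact_mod_cast hm
  -- the lifted offsets differ by at most `n + m` in every direction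
  have hdiff : ∀ ν, |((A ν : ℕ) : ℝ) - ((A' ν : ℕ) : ℝ)| ≤ (n : ℝ) + m := by
    intro ν
    obtain ⟨hl, hr⟩ := hover ν
    have hl' : ((a ν : ℕ) : ℝ) * m < (((a' ν : ℕ) : ℝ) + 1) * n := by exact_mod_cast hl
    have hr' : ((a' ν : ℕ) : ℝ) * n < (((a ν : ℕ) : ℝ) + 1) * m := by exact_mod_cast hr
    show |((((a ν : ℕ) * m : ℕ)) : ℝ) - ((((a' ν : ℕ) * n : ℕ)) : ℝ)| ≤ (n : ℝ) + m
    push_cast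
    rw [abs_le]
    constructor <;> nlinarith
  have hsum : (∑ ν, |((A ν : ℕ) : ℝ) - ((A' ν : ℕ) : ℝ)|) ≤ (d + 1) * ((n : ℝ) + m) := by
    calc (∑ ν, |((A ν : ℕ) : ℝ) - ((A' ν : ℕ) : ℝ)|) ≤ ∑ _ν : Fin (d + 1), ((n : ℝ) + m) :=
          Finset.sum_le_sum fun ν _ => hdiff ν
      _ = (d + 1) * ((n : ℝ) + m) := by
          rw [Finset.sum_const, Finset.card_univ, Fintype.card_fin, nsmul_eq_mul]; push_cast; ring
  have h3' : ‖HkOp (n * m) M (bpt (n * m) M (toT M x') A, μ) (toT M x, lam)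
        - HkOp (n * m) M (bpt (n * m) M (toT M x') A', μ) (toT M x, lam)‖
      ≤ (d + 1) * ((n : ℝ) + m) * (((n * m : ℕ) : ℝ)⁻¹ * (KHd d * e)) :=
    h3.trans (mul_le_mul_of_nonneg_right hsum (by positivity))
  -- triangle through level `n·m`
  set P := HkOp m M (bpt m M (toT M x') a', μ) (toT M x, lam) with hP
  set Q := HkOp n M (bpt n M (toT M x') a, μ) (toT M x, lam) with hQ
  set RA := HkOp (n * m) M (bpt (n * m) M (toT M x') A, μ) (toT M x, lam) with hRA
  set RA' := HkOp (n * m) M (bpt (n * m) M (toT M x') A', μ) (toT M x, lam) with hRA'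
  have htri : ‖P - Q‖ ≤ ‖RA' - P‖ + ‖RA - RA'‖ + ‖RA - Q‖ :=
    calc ‖P - Q‖ = ‖(RA - Q) - (RA - RA') - (RA' - P)‖ := by congr 1; abel
      _ ≤ ‖(RA - Q) - (RA - RA')‖ + ‖RA' - P‖ := norm_sub_le _ _
      _ ≤ ‖RA - Q‖ + ‖RA - RA'‖ + ‖RA' - P‖ := add_le_add (norm_sub_le _ _) le_rfl
      _ = ‖RA' - P‖ + ‖RA - RA'‖ + ‖RA - Q‖ := by ring
  refine htri.trans ((add_le_add (add_le_add h2 h3') h1).trans (le_of_eq ?_))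
  push_cast
  field_simp
  ring

omit [NeZero n] [NeZero m] in
/-- **the digits of one real overlap**: for `n, m ≥ 1` and `s ≥ 0`, the cells of `⌊n s⌋` (level `n`) and `⌊m s⌋` (level `m`) overlap — both contain `s`.
[folklore] -/
theorem floor_cells_overlap (hn : 0 < n) (hm : 0 < m) {s : ℝ} (hs : 0 ≤ s) :
    ⌊(n : ℝ) * s⌋₊ * m < (⌊(m : ℝ) * s⌋₊ + 1) * n ∧ ⌊(m : ℝ) * s⌋₊ * n < (⌊(n : ℝ) * s⌋₊ + 1) * m := by
  have key : ∀ {p q : ℕ}, (0 : ℝ) < p → (0 : ℝ) < q → ⌊(p : ℝ) * s⌋₊ * q < (⌊(q : ℝ) * s⌋₊ + 1) * p := by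
    intro p q hp hq
    have h1 : (⌊(p : ℝ) * s⌋₊ : ℝ) ≤ p * s := Nat.floor_le (by positivity)
    have h2 : (q : ℝ) * s < ⌊(q : ℝ) * s⌋₊ + 1 := Nat.lt_floor_add_one _
    have h3 : (⌊(p : ℝ) * s⌋₊ : ℝ) * q < (⌊(q : ℝ) * s⌋₊ + 1) * p :=
      calc (⌊(p : ℝ) * s⌋₊ : ℝ) * q ≤ p * s * q := mul_le_mul_of_nonneg_right h1 hq.le
        _ = (q * s) * p := by ring
        _ < (⌊(q : ℝ) * s⌋₊ + 1) * p := mul_lt_mul_of_pos_right h2 hp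
    exact_mod_cast h3
  have hn0 : (0 : ℝ) < n := by exact_mod_cast hn
  have hm0 : (0 : ℝ) < m := by exact_mod_cast hm
  exact ⟨key hn0 hm0, key hm0 hn0⟩

/-- **THE `η`-RATE CAUCHY ESTIMATE AT A CONTINUUM OFFSET**: for levels `n, m ≥ 1`, an offset `t ∈ ℝ^{d+1}` with `t ≥ 0`, and the digit vectors
`a = ⌊n t⌋ ∈ (Fin n)^{d+1}`, `a′ = ⌊m t⌋ ∈ (Fin m)^{d+1}` (hypotheses `ha`, `ha′`; they force `t_ν < 1`),
`‖H_m((m·ȳ′+a′,μ),(ȳ,λ)) − H_n((n·ȳ′+a,μ),(ȳ,λ))‖ ≤ (CGe·periodConst + (d+1)·KHd)·(n⁻¹ + m⁻¹)·e^{−dec·|y′−y|_T}` — i.e.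
`‖H^{(η)} − H^{(η′)}‖ ≤ KHc·(η + η′)·e^{−dec|·|}` read at the same continuum point. [folklore] -/
theorem norm_HkOp_floor_sub_floor_le (μ lam : Fin (d + 1)) (x' x : Fin (d + 1) → ℤ) (t : Fin (d + 1) → ℝ) (ht : ∀ ν, 0 ≤ t ν)
    (a : Fin (d + 1) → Fin n) (a' : Fin (d + 1) → Fin m) (ha : ∀ ν, (a ν : ℕ) = ⌊(n : ℝ) * t ν⌋₊)
    (ha' : ∀ ν, (a' ν : ℕ) = ⌊(m : ℝ) * t ν⌋₊) :
    ‖HkOp m M (bpt m M (toT M x') a', μ) (toT M x, lam) - HkOp n M (bpt n M (toT M x') a, μ) (toT M x, lam)‖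
      ≤ (CGe (d + 1) * periodConst (kappa163 (d + 1)) d + (d + 1) * KHd d) * (((n : ℝ))⁻¹ + ((m : ℝ))⁻¹)
          * Real.exp (-(dec d * torusSupNorm M (x' - x))) :=
  norm_HkOp_sub_of_overlap_le M μ lam x' x a a' fun ν => by
    rw [ha ν, ha' ν]
    exact floor_cells_overlap (Nat.pos_of_ne_zero (NeZero.ne n)) (Nat.pos_of_ne_zero (NeZero.ne m)) (ht ν)

end TwoLevels

/-! ## §3 Digit bookkeeping for a continuum offset -/

section Digits

/-- the digits of an offset in `[0,1)` are admissible: `⌊n s⌋ < n`. [folklore] -/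
theorem floor_lt_level (n : ℕ) [NeZero n] {s : ℝ} (hs0 : 0 ≤ s) (hs1 : s < 1) : ⌊(n : ℝ) * s⌋₊ < n := by
  have hn : (0 : ℝ) < n := by exact_mod_cast Nat.pos_of_ne_zero (NeZero.ne n)
  rw [Nat.floor_lt (by positivity)]
  calc (n : ℝ) * s < n * 1 := mul_lt_mul_of_pos_left hs1 hn
    _ = n := mul_one _

/-- floors of nearby non-negative reals: `|⌊x⌋ − ⌊y⌋| ≤ |x − y| + 1`. [folklore] -/
theorem abs_floor_sub_floor_le {x y : ℝ} (hx : 0 ≤ x) (hy : 0 ≤ y) :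
    |((⌊x⌋₊ : ℕ) : ℝ) - ((⌊y⌋₊ : ℕ) : ℝ)| ≤ |x - y| + 1 := by
  have hx1 : (⌊x⌋₊ : ℝ) ≤ x := Nat.floor_le hx
  have hx2 : x < ⌊x⌋₊ + 1 := Nat.lt_floor_add_one _
  have hy1 : (⌊y⌋₊ : ℝ) ≤ y := Nat.floor_le hy
  have hy2 : y < ⌊y⌋₊ + 1 := Nat.lt_floor_add_one _
  rw [abs_le]
  constructor
  · have := neg_abs_le (x - y); linarith
  · have := le_abs_self (x - y); linarith

end Digits

/-! ## §4 The King reading: the digits of one offset along `N ↦ L·N` ARE King's ancestry -/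

section King

variable (M : Fin (d + 1) → ℕ) [hM : ∀ μ, NeZero (M μ)]

omit hM in
/-- `⌊(L·N)·s⌋ ∕ L = ⌊N·s⌋` for `s ≥ 0` (`Nat.floor_div_natCast`). [folklore] -/
theorem floor_mul_div (L N : ℕ) [NeZero L] (s : ℝ) : ⌊((L * N : ℕ) : ℝ) * s⌋₊ / L = ⌊(N : ℝ) * s⌋₊ := by
  have hL : (L : ℝ) ≠ 0 := by exact_mod_cast NeZero.ne L
  rw [Nat.cast_mul, mul_assoc, ← Nat.floor_div_natCast, mul_div_cancel_left₀ _ hL]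

/-- **KING's PARENT OF THE LEVEL-`L·N` COHERENT POINT IS THE LEVEL-`N` COHERENT POINT**: for an offset `t` and the digit vectors `a′ = ⌊(L·N) t⌋`,
`a = ⌊N t⌋`, `par N L M (bpt (L·N) M ȳ a′) = bpt N M ȳ a` (`HkKingOneStepSup.par_bpt` + `floor_mul_div`).  Hence `HkKingOneStep.norm_HkOp_king_sub_le`
compares consecutive members of §3's convergent sequence, and each King tower `N = L^k` converges to the kernel `Hc t` of `exists_HkOp_continuum_kernel`.
[cite: King1986, p.664 («When x′ ∈ T_{η′}, we denote by x that point in T_η for which x′ ∈ B^n(x)»)] [folklore] -/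
theorem par_bpt_floor {N L : ℕ} [NeZero N] [NeZero L] (t : Fin (d + 1) → ℝ) (y : Tor M)
    (a' : Fin (d + 1) → Fin (L * N)) (a : Fin (d + 1) → Fin N)
    (ha' : ∀ ν, (a' ν : ℕ) = ⌊((L * N : ℕ) : ℝ) * t ν⌋₊) (ha : ∀ ν, (a ν : ℕ) = ⌊(N : ℝ) * t ν⌋₊) :
    par N L M (bpt (L * N) M y a') = bpt N M y a := by
  rw [par_bpt]
  congr 1
  funext ν
  apply Fin.ext
  show (a' ν : ℕ) / L = (a ν : ℕ)
  rw [ha' ν, ha ν, floor_mul_div L N (t ν)]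

end King

end Summit.QuantumFields.BalabanUV.Beta.GAN24.HkContinuumKernel

end
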